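import Summits.QuantumFields.YangMills.Theorems.AlphaInputsT3ACv3LinearLiftFlux
import HarnessLib

/-!
# `AlphaInputsT3ACv3LinearLiftFluxPrefix` — «ZCLASS» STEP 1: PREFIX SUMS ALONG ONE LATTICE DIRECTION ON THE DISCRETE TORUS (the integration tool of the integer class
# decomposition) — cell `ym3-torus`, width seat `ym-ust-20520-w5` (g8), line «SYM-CENTRE» (EX cure (ii-a)); companion of ✓`AlphaInputsT3ACv3LinearLiftFlux` («FLUX-LIFT», p675255)

WHY.  The (R4) assembly must split the INTEGER part `m` of `curl θ` (an integer 2-cocycle on `T^{(k)}`) as `m = Σ_{μ<ν} q_{μν}·E_{μν} + curl s` with an INTEGER one-cochain `s`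
(«ZCLASS»; then `θ − 2π·s` has the same `SU(2)` field and a STANDARD integer part, which ✓`exists_fluxLift` lifts).  The decomposition is built by five sweeps, each an
«integration along one direction with a seam correction»; THIS FILE is the one tool they share, on a general torus `Site P j` (any `d`, any direction `κ`), for INTEGER-valued
site functions: `colAt x κ t` (the site `x` with its `κ`-th label set to `t`), the PREFIX SUM `pre κ f x = Σ_{t < x_κ} f(colAt x κ t)` and the PERIOD `tot κ f x = Σ_{t < M} f(colAt x κ t)`,
with: §2 ★`pre_shift_self` — THE STEP `pre κ f (x + e_κ) = pre κ f x + f x − [x_κ = −1]·tot κ f x` (the seam term at the last residue); §3 `pre_shift_ne`∕`tot_shift_ne` (a shift in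
another direction passes inside), `tot_colAt` (the period does not see `x_κ`), `pre_colAt_zero`; §4 linearity; §5 ★`pre_sub_shift` — TELESCOPING `pre κ (f(· + e_κ) − f) x = f x − f(colAt x κ 0)`;
§6 ★`colAt_eq_of_shift_invariant` — a function invariant under `+e_κ` does not depend on `x_κ`; `pre_indep`∕`tot_indep` — independence of another coordinate is inherited.
HONEST FRAMING.  Elementary `ZMod`∕`Finset` bookkeeping; nothing of [Balaban] is asserted; count-neutral helper toward EX (`--supports stmt-QuantumFields-19200 --as helper`); three small
definitions (`colAt`, `pre`, `tot`; review lane), every landed file untouched.  YM₃ on the torus is a RUNG (R3), not the Clay problem; no claim about d = 4, infinite volume or a mass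
gap; nothing of the stub ∕ crux is claimed.

References: T. Bałaban, Commun. Math. Phys. 109 (1987) 249–301 [Balaban1987RG1] ((0.1) p.251: the tori `T^{(j)}` and their integer labels).
-/

set_option autoImplicit false

noncomputable section

namespace Summit.QuantumFields.YangMills.Theorems.LinearLiftFlux

open scoped BigOperators
open Finset
open Literature.MathematicalPhysics.QuantumFieldTheory.Balaban1983to89

variable {P : Params} {j : ℕ}

/-! ## §1 The column through a site -/

/-- **`colAt x κ t`**: the site `x` with its `κ`-th label replaced by `t` (read modulo the site count). [cite: Balaban1987RG1, (0.1) p.251] -/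
def colAt (x : Site P j) (κ : Fin P.d) (t : ℕ) : Site P j := Function.update x κ ((t : ℕ) : ZMod (P.sitesPerDir j))

/-- **THE PREFIX SUM** of an integer site function along direction `κ` up to (excluding) the label `x_κ`. [folklore] -/
def pre (κ : Fin P.d) (f : Site P j → ℤ) (x : Site P j) : ℤ := ∑ t ∈ range (x κ).val, f (colAt x κ t)

/-- **THE PERIOD**: the sum of an integer site function over the whole `κ`-circle through `x`. [folklore] -/
def tot (κ : Fin P.d) (f : Site P j → ℤ) (x : Site P j) : ℤ := ∑ t ∈ range (P.sitesPerDir j), f (colAt x κ t)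

/-- The replaced coordinate. [folklore] -/
theorem colAt_apply_self (x : Site P j) (κ : Fin P.d) (t : ℕ) : colAt x κ t κ = ((t : ℕ) : ZMod (P.sitesPerDir j)) := by
  simp [colAt]

/-- The other coordinates are untouched. [folklore] -/
theorem colAt_apply_ne (x : Site P j) {κ lam : Fin P.d} (h : lam ≠ κ) (t : ℕ) : colAt x κ t lam = x lam := by
  simp [colAt, h]

/-- Replacing the `κ`-th label by its own value does nothing. [folklore] -/
theorem colAt_val_self (x : Site P j) (κ : Fin P.d) : colAt x κ (x κ).val = x := by
  unfold colAt; rw [ZMod.natCast_zmod_val, Function.update_eq_self]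

/-- Two replacements of the same coordinate: the last one wins. [folklore] -/
theorem colAt_colAt_self (x : Site P j) (κ : Fin P.d) (t t' : ℕ) : colAt (colAt x κ t) κ t' = colAt x κ t' := by
  unfold colAt; rw [Function.update_idem]

/-- Replacements of two different coordinates commute. [folklore] -/
theorem colAt_colAt_comm (x : Site P j) {κ lam : Fin P.d} (h : κ ≠ lam) (t t' : ℕ) : colAt (colAt x κ t) lam t' = colAt (colAt x lam t') κ t := by
  unfold colAt; rw [Function.update_comm h]

/-- **THE UNIT SHIFT AS A REPLACEMENT**: `x + e_κ = colAt x κ (x_κ.val + 1)`. [folklore] -/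
theorem shift_eq_colAt (x : Site P j) (κ : Fin P.d) : x.shift κ = colAt x κ ((x κ).val + 1) := by
  funext lam
  by_cases h : lam = κ
  · subst h; rw [Site.shift_apply, if_pos rfl, colAt_apply_self, Nat.cast_succ, ZMod.natCast_zmod_val]
  · rw [Site.shift_apply, if_neg h, colAt_apply_ne x h]

/-- A replacement of `x_κ` followed by `+e_κ` is the next replacement. [folklore] -/
theorem colAt_shift_self (x : Site P j) (κ : Fin P.d) (t : ℕ) : (colAt x κ t).shift κ = colAt x κ (t + 1) := by
  funext lam
  by_cases h : lam = κ
  · subst h; rw [Site.shift_apply, if_pos rfl, colAt_apply_self, colAt_apply_self, Nat.cast_succ]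
  · rw [Site.shift_apply, if_neg h, colAt_apply_ne x h, colAt_apply_ne x h]

/-- A shift in ANOTHER direction commutes with the replacement. [folklore] -/
theorem colAt_shift_ne (x : Site P j) {κ lam : Fin P.d} (h : lam ≠ κ) (t : ℕ) : (colAt x κ t).shift lam = colAt (x.shift lam) κ t := by
  funext ι
  by_cases h1 : ι = lam
  · subst h1; rw [Site.shift_apply, if_pos rfl, colAt_apply_ne x h, colAt_apply_ne _ h, Site.shift_apply, if_pos rfl]
  · rw [Site.shift_apply, if_neg h1]
    by_cases h2 : ι = κ
    · subst h2; rw [colAt_apply_self, colAt_apply_self]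
    · rw [colAt_apply_ne x h2, colAt_apply_ne _ h2, Site.shift_apply, if_neg h1]

/-! ## §2 The step of the prefix sum -/

/-- **★ THE STEP**: `pre κ f (x + e_κ) = pre κ f x + f x − [x_κ = −1]·tot κ f x` — inside the circle the prefix sum grows by the current value; crossing the seam `x_κ = −1 → 0` it
resets, losing the whole period. [folklore] -/
theorem pre_shift_self (κ : Fin P.d) (f : Site P j → ℤ) (x : Site P j) :
    pre κ f (x.shift κ) = pre κ f x + f x - (if x κ = -1 then tot κ f x else 0) := by
  have hM := P.one_lt_sitesPerDir j
  have hcol : ∀ t, colAt (x.shift κ) κ t = colAt x κ t := fun t => by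
    rw [shift_eq_colAt, colAt_colAt_self]
  unfold pre
  simp_rw [hcol]
  have hs : (x.shift κ) κ = x κ + 1 := by rw [Site.shift_apply, if_pos rfl]
  rw [hs, val_add_one_eq]
  by_cases h : x κ = -1
  · rw [if_pos h, if_pos h]
    have hv : (x κ).val = P.sitesPerDir j - 1 := (eq_neg_one_iff_val _).mp h
    unfold tot
    rw [hv, show P.sitesPerDir j = (P.sitesPerDir j - 1) + 1 by omega, Finset.sum_range_succ, Nat.add_sub_cancel, ← hv, colAt_val_self]
    simp
  · rw [if_neg h, if_neg h, Finset.sum_range_succ, colAt_val_self]; ring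

/-! ## §3 Shifts in other directions, replacements, periods -/

/-- A shift in another direction passes inside the prefix sum. [folklore] -/
theorem pre_shift_ne (κ : Fin P.d) (f : Site P j → ℤ) (x : Site P j) {lam : Fin P.d} (h : lam ≠ κ) :
    pre κ f (x.shift lam) = pre κ (fun y => f (y.shift lam)) x := by
  unfold pre
  rw [Site.shift_apply, if_neg (Ne.symm h)]
  exact Finset.sum_congr rfl fun t _ => by rw [← colAt_shift_ne x h]

/-- A shift in another direction passes inside the period. [folklore] -/
theorem tot_shift_ne (κ : Fin P.d) (f : Site P j → ℤ) (x : Site P j) {lam : Fin P.d} (h : lam ≠ κ) :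
    tot κ f (x.shift lam) = tot κ (fun y => f (y.shift lam)) x := by
  unfold tot
  exact Finset.sum_congr rfl fun t _ => by rw [← colAt_shift_ne x h]

/-- The period does not see the `κ`-th label. [folklore] -/
theorem tot_colAt (κ : Fin P.d) (f : Site P j → ℤ) (x : Site P j) (t : ℕ) : tot κ f (colAt x κ t) = tot κ f x := by
  unfold tot
  exact Finset.sum_congr rfl fun t' _ => by rw [colAt_colAt_self]

/-- The period is invariant under `+e_κ`. [folklore] -/
theorem tot_shift_self (κ : Fin P.d) (f : Site P j → ℤ) (x : Site P j) : tot κ f (x.shift κ) = tot κ f x := by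
  rw [shift_eq_colAt, tot_colAt]

/-- At the start of the circle the prefix sum is empty. [folklore] -/
theorem pre_colAt_zero (κ : Fin P.d) (f : Site P j → ℤ) (x : Site P j) : pre κ f (colAt x κ 0) = 0 := by
  unfold pre
  rw [colAt_apply_self, Nat.cast_zero, ZMod.val_zero, Finset.sum_range_zero]

/-- A replacement in another direction passes inside the prefix sum. [folklore] -/
theorem pre_colAt_ne (κ : Fin P.d) (f : Site P j → ℤ) (x : Site P j) {lam : Fin P.d} (h : lam ≠ κ) (t : ℕ) :
    pre κ f (colAt x lam t) = pre κ (fun y => f (colAt y lam t)) x := by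
  unfold pre
  rw [colAt_apply_ne x (Ne.symm h)]
  exact Finset.sum_congr rfl fun t' _ => by rw [colAt_colAt_comm x h]

/-- A replacement in another direction passes inside the period. [folklore] -/
theorem tot_colAt_ne (κ : Fin P.d) (f : Site P j → ℤ) (x : Site P j) {lam : Fin P.d} (h : lam ≠ κ) (t : ℕ) :
    tot κ f (colAt x lam t) = tot κ (fun y => f (colAt y lam t)) x := by
  unfold tot
  exact Finset.sum_congr rfl fun t' _ => by rw [colAt_colAt_comm x h]

/-! ## §4 Linearity -/

/-- The prefix sum is additive. [folklore] -/
theorem pre_add (κ : Fin P.d) (f g : Site P j → ℤ) (x : Site P j) : pre κ (fun y => f y + g y) x = pre κ f x + pre κ g x := by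
  unfold pre; rw [Finset.sum_add_distrib]

/-- The prefix sum commutes with subtraction. [folklore] -/
theorem pre_sub (κ : Fin P.d) (f g : Site P j → ℤ) (x : Site P j) : pre κ (fun y => f y - g y) x = pre κ f x - pre κ g x := by
  unfold pre; rw [Finset.sum_sub_distrib]

/-- The prefix sum commutes with an integer factor. [folklore] -/
theorem pre_mul (κ : Fin P.d) (c : ℤ) (f : Site P j → ℤ) (x : Site P j) : pre κ (fun y => c * f y) x = c * pre κ f x := by
  unfold pre; rw [Finset.mul_sum]

/-- The period is additive. [folklore] -/
theorem tot_add (κ : Fin P.d) (f g : Site P j → ℤ) (x : Site P j) : tot κ (fun y => f y + g y) x = tot κ f x + tot κ g x := by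
  unfold tot; rw [Finset.sum_add_distrib]

/-- The period commutes with subtraction. [folklore] -/
theorem tot_sub (κ : Fin P.d) (f g : Site P j → ℤ) (x : Site P j) : tot κ (fun y => f y - g y) x = tot κ f x - tot κ g x := by
  unfold tot; rw [Finset.sum_sub_distrib]

/-- The period commutes with an integer factor. [folklore] -/
theorem tot_mul (κ : Fin P.d) (c : ℤ) (f : Site P j → ℤ) (x : Site P j) : tot κ (fun y => c * f y) x = c * tot κ f x := by
  unfold tot; rw [Finset.mul_sum]

/-- Pointwise-equal summands give equal prefix sums. [folklore] -/
theorem pre_congr (κ : Fin P.d) {f g : Site P j → ℤ} (h : ∀ y, f y = g y) (x : Site P j) : pre κ f x = pre κ g x := by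
  unfold pre; exact Finset.sum_congr rfl fun t _ => h _

/-- Pointwise-equal summands give equal periods. [folklore] -/
theorem tot_congr (κ : Fin P.d) {f g : Site P j → ℤ} (h : ∀ y, f y = g y) (x : Site P j) : tot κ f x = tot κ g x := by
  unfold tot; exact Finset.sum_congr rfl fun t _ => h _

/-! ## §5 Telescoping -/

/-- **★ TELESCOPING**: `pre κ (f(· + e_κ) − f) x = f x − f(colAt x κ 0)`. [folklore] -/
theorem pre_sub_shift (κ : Fin P.d) (f : Site P j → ℤ) (x : Site P j) :
    pre κ (fun y => f (y.shift κ) - f y) x = f x - f (colAt x κ 0) := by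
  unfold pre
  have e : ∀ t ∈ range (x κ).val, (f ((colAt x κ t).shift κ) - f (colAt x κ t)) = (f (colAt x κ (t + 1)) - f (colAt x κ t)) := by
    intro t _; rw [colAt_shift_self]
  rw [Finset.sum_congr rfl e, Finset.sum_range_sub (fun t => f (colAt x κ t)), colAt_val_self]

/-- **TELESCOPING OVER THE WHOLE CIRCLE**: the period of `f(· + e_κ) − f` vanishes. [folklore] -/
theorem tot_sub_shift (κ : Fin P.d) (f : Site P j → ℤ) (x : Site P j) : tot κ (fun y => f (y.shift κ) - f y) x = 0 := by
  unfold tot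
  have e : ∀ t ∈ range (P.sitesPerDir j), (f ((colAt x κ t).shift κ) - f (colAt x κ t)) = (f (colAt x κ (t + 1)) - f (colAt x κ t)) := by
    intro t _; rw [colAt_shift_self]
  rw [Finset.sum_congr rfl e, Finset.sum_range_sub (fun t => f (colAt x κ t))]
  have hN : colAt x κ (P.sitesPerDir j) = colAt x κ 0 := by
    unfold colAt; rw [ZMod.natCast_self, Nat.cast_zero]
  rw [hN]; ring

/-! ## §6 Independence of a coordinate -/

/-- **★ A FUNCTION INVARIANT UNDER `+e_κ` DOES NOT DEPEND ON `x_κ`.** [folklore] -/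
theorem colAt_eq_of_shift_invariant (κ : Fin P.d) (f : Site P j → ℤ) (h : ∀ y, f (y.shift κ) = f y) (x : Site P j) (t : ℕ) :
    f (colAt x κ t) = f x := by
  have h0 : ∀ n : ℕ, f (colAt x κ n) = f (colAt x κ 0) := by
    intro n
    induction n with
    | zero => rfl
    | succ n ih => rw [← colAt_shift_self, h, ih]
  rw [h0 t, ← h0 (x κ).val, colAt_val_self]

/-- If `f` does not depend on `x_λ` then neither does its prefix sum along another direction. [folklore] -/
theorem pre_indep (κ : Fin P.d) (f : Site P j → ℤ) {lam : Fin P.d} (h : lam ≠ κ) (hf : ∀ y t, f (colAt y lam t) = f y) (x : Site P j) (t : ℕ) :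
    pre κ f (colAt x lam t) = pre κ f x := by
  rw [pre_colAt_ne κ f x h]
  exact pre_congr κ (fun y => hf y t) x

/-- If `f` does not depend on `x_λ` then neither does its period along another direction. [folklore] -/
theorem tot_indep (κ : Fin P.d) (f : Site P j → ℤ) {lam : Fin P.d} (h : lam ≠ κ) (hf : ∀ y t, f (colAt y lam t) = f y) (x : Site P j) (t : ℕ) :
    tot κ f (colAt x lam t) = tot κ f x := by
  rw [tot_colAt_ne κ f x h]
  exact tot_congr κ (fun y => hf y t) x

/-- If `f` does not depend on `x_λ` it is invariant under `+e_λ`. [folklore] -/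
theorem shift_invariant_of_indep (lam : Fin P.d) (f : Site P j → ℤ) (hf : ∀ y t, f (colAt y lam t) = f y) (x : Site P j) : f (x.shift lam) = f x := by
  rw [shift_eq_colAt, hf]

/-- The indicator of the last residue does not depend on the other coordinates. [folklore] -/
theorem ite_colAt_ne (x : Site P j) {κ lam : Fin P.d} (h : lam ≠ κ) (t : ℕ) (a b : ℤ) :
    (if colAt x lam t κ = -1 then a else b) = if x κ = -1 then a else b := by
  rw [colAt_apply_ne x (Ne.symm h)]

end Summit.QuantumFields.YangMills.Theorems.LinearLiftFlux

end
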